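import Literature.AlgebraicTopology.SingularHomology.SuspensionDecomposition
import Literature.AlgebraicTopology.SingularHomology.CupProductProofs
import HarnessLib

/-!
# The fibre step of the Leray–Hirsch theorem for projective bundles (abstract form)

Topic `Literature/AlgebraicTopology/SingularHomology`. D. Husemoller, *Fibre Bundles*, 3rd ed.
(1994), Ch. 17 §1 (Leray–Hirsch over a trivialising open set: the product case) and §2 (2.3),
Thm. 2.5 (the fibre `ℂPⁿ⁻¹`: `1, x, …, xⁿ⁻¹` is a base of `H*(ℂPⁿ⁻¹)`), proved as in A. Hatcher,
*Algebraic Topology* (2002), Example 3.40 / Thm. 3.19: cover the fibre by the complement `A₀` of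
a hyperplane (a cell) and the complement `C₀` of a point (which retracts onto the hyperplane
`ℂPⁿ⁻²`); their intersection is a sphere `S²ⁿ⁻³`, and the Mayer–Vietoris coboundary of its
class is `± xⁿ⁻¹`.

Abstract form, with parameters: a map `p : X → T`, open `A`, `C ⊆ X`, global cocycles `β k`
(`k : ι`, degrees `d k`) acting by `⌣ β k` (`SimplexSpan.cupRightH`), pulled-back base classes
`pullT p W : H*(T) → H*_X(W)` (`SuspensionDecomposition.lean`), and the comparison maps
`θ_W (c) = Σₛ p*(c_s) ⌣ β_{k(s)}` (`lhMapT`, indexed by `LHSubset.Idx`).  **Theorem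
(`isLHTR_union`)**: if
* `p*` is bijective onto `H*_X(A)` and the `β k`, `k ≠ b`, act by zero on `H*_X(A)`, while
  `β b = p^♯φ_b` is pulled back from the base;
* over `C`, `θ` restricted to the indices outside a set `PC ∋ t` is bijective (`IsLHTR`) and the
  `β k`, `k ∈ PC`, act by zero;
* `s ∈ Hᴺ_X(A ∩ C)` gives a two-summand decomposition (`TwoSummand`) and
  `δ s = u • (p*1 ⌣ β t)` for a unit `u`, `d t = N + 1` even;
then `θ : ⊕ₛ H^{e(s)}(T) → Hⁿ_X(A ∪ C)` is bijective for the family of indices outside `PC ∖ {t}`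
(`isLHTR_union`), in every degree `n`.

Everything is proved; no named facts.

## References

* [HusemollerFibreBundles1994] D. Husemoller, *Fibre Bundles*, 3rd ed. (1994), Ch. 17 §1
  Thm. 1.1, §2 (2.3), Thm. 2.5.
* [HatcherAT2002] A. Hatcher, *Algebraic Topology*, CUP 2002, Example 3.40, Thm. 3.19, §3.1 p. 204.
-/

noncomputable section

-- as in `SuspensionDecomposition`: chains of the concrete complex are `Finsupp`s up to unfolding
-- of semireducible definitions
set_option backward.isDefEq.respectTransparency false

open CategoryTheory Limits

universe u v

namespace Literature.AlgebraicTopology.SingularHomology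

namespace subsetCochains

variable {R : Type v} [CommRing R] {X T : Type u} [TopologicalSpace X] [TopologicalSpace T]
  (p : C(X, T)) {ι : Type} [Fintype ι] (d : ι → ℕ) (β : (k : ι) → SingularSimplex X (d k) → R)
  (hβ : ∀ k, (singularCochainComplex R R X).d (d k) (d k + 1) (β k) = 0)

/-- Local notation: the coefficient object `ULift R` of `ModuleCat.{max u v} R`. -/
local notation "𝑹" => SimplexSpan.coefR R

/-! ### The comparison maps with base classes from `H*(T)` -/

/-- **The source `⊕_{e + d k = n} Hᵉ(T)`** of the comparison map over a product-like piece. [cite: HusemollerFibreBundles1994, Ch. 17 §1 Thm. 1.1 (proof)] -/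
abbrev SrcT (n : ℕ) : Type (max u v) := (s : LHSubset.Idx d n) → singularCohomology R R T s.deg

/-- **The comparison map `θ_W(c) = Σₛ p*(c_s) ⌣ β_{k(s)}`** with base classes from `H*(T)`.
[cite: HusemollerFibreBundles1994, Ch. 17 §1 Thm. 1.1 (proof)] -/
def lhMapT (W : Set X) (n : ℕ) : SrcT (R := R) (T := T) d n →ₗ[R] (subsetCochains R 𝑹 W).homology n :=
  ∑ s : LHSubset.Idx d n,
    ((SimplexSpan.ofSet (R := R) W).cupRightH (SimplexSpan.frontBackClosed_ofSet _) (β s.cls) (hβ s.cls)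
        s.2) ∘ₗ pullT p W s.deg ∘ₗ LinearMap.proj s

/-- `θ_W` evaluated. [folklore] -/
theorem lhMapT_apply (W : Set X) (n : ℕ) (c : SrcT (R := R) (T := T) d n) :
    lhMapT p d β hβ W n c = ∑ s : LHSubset.Idx d n,
      (SimplexSpan.ofSet (R := R) W).cupRightH (SimplexSpan.frontBackClosed_ofSet _) (β s.cls) (hβ s.cls)
        s.2 (pullT p W s.deg (c s)) := by
  rw [lhMapT, LinearMap.sum_apply]
  rfl

/-- **`θ` commutes with restriction** (same base classes). [folklore] -/
theorem resH_lhMapT {W W' : Set X} (hW : W' ⊆ W) (n : ℕ) (c : SrcT (R := R) (T := T) d n) :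
    resH (N := 𝑹) hW n (lhMapT p d β hβ W n c) = lhMapT p d β hβ W' n c := by
  rw [lhMapT_apply, lhMapT_apply, map_sum]
  refine Finset.sum_congr rfl fun s _ ↦ ?_
  have h1 := (SimplexSpan.ofSet (R := R) W).homologyMap_dualMap_cupRightH (SimplexSpan.frontBackClosed_ofSet _)
    (β s.cls) (hβ s.cls) (SimplexSpan.ofSet (R := R) W') (chainsInSub_mono R R hW)
    (SimplexSpan.frontBackClosed_ofSet _) (fun hσ ↦ hσ.trans hW) s.2 (pullT p W s.deg (c s))
  exact h1.trans (congrArg _ (resH_pullT p hW s.deg (c s)))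

/-- **Leray–Hirsch over `W` with base classes from `H*(T)`**: zero kernel and surjective. [cite: HusemollerFibreBundles1994, Ch. 17 §1 Thm. 1.1 (proof)] -/
def IsLHT (W : Set X) : Prop :=
  ∀ n, (∀ c, lhMapT p d β hβ W n c = 0 → c = 0) ∧ Function.Surjective (lhMapT p d β hβ W n)

/-- **Leray–Hirsch over `W` for the sub-family of indices NOT satisfying `P`**: `θ` is injective on
the sources vanishing at the classes in `P` and every class is `θ` of such a source (used with
`P k ⇔ "xᵏ = 0 on the piece"`, i.e. `k ≥` the dimension of the projective space at hand).
[cite: HusemollerFibreBundles1994, Ch. 17 §1 Thm. 1.1 (proof)] -/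
def IsLHTR (P : ι → Prop) (W : Set X) : Prop :=
  ∀ n, (∀ c : SrcT (R := R) (T := T) d n, (∀ s : LHSubset.Idx d n, P s.cls → c s = 0) →
      lhMapT p d β hβ W n c = 0 → c = 0) ∧
    ∀ y, ∃ c : SrcT (R := R) (T := T) d n, (∀ s : LHSubset.Idx d n, P s.cls → c s = 0) ∧
      lhMapT p d β hβ W n c = y

omit [Fintype ι] in
/-- Leray–Hirsch for the full family is the case `P = ⊥` of the restricted form. [folklore] -/
theorem isLHT_iff_isLHTR_bot [Fintype ι] (W : Set X) :
    IsLHT p d β hβ W ↔ IsLHTR p d β hβ (fun _ ↦ False) W := by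
  constructor
  · intro h n
    exact ⟨fun c _ hc ↦ (h n).1 c hc, fun y ↦ by obtain ⟨c, rfl⟩ := (h n).2 y; exact ⟨c, fun _ h ↦ h.elim, rfl⟩⟩
  · intro h n
    exact ⟨fun c hc ↦ (h n).1 c (fun _ h ↦ h.elim) hc, fun y ↦ by obtain ⟨c, -, rfl⟩ := (h n).2 y; exact ⟨c, rfl⟩⟩

/-! ### Single-index sources -/

variable {d} in
/-- The index `(k, e)` of degree `n = e + d k`. [folklore] -/
abbrev idxOf (k : ι) (e : ℕ) {n : ℕ} (h : e + d k = n) : LHSubset.Idx d n :=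
  ⟨(k, ⟨e, by omega⟩), h⟩

omit [Fintype ι] in
variable {d} in
/-- An index with class `k` is `idxOf k _`. [folklore] -/
theorem idx_eq_idxOf {n : ℕ} (s : LHSubset.Idx d n) : s = idxOf s.cls s.deg s.2 := by
  obtain ⟨⟨k, ⟨e, he⟩⟩, h⟩ := s
  rfl

omit [Fintype ι] in
variable {d} in
/-- Two indices of the same degree with the same class are equal. [folklore] -/
theorem idx_eq_of_cls_eq {n : ℕ} (s s' : LHSubset.Idx d n) (h : s.cls = s'.cls) : s = s' := by
  obtain ⟨⟨k, ⟨e, he⟩⟩, hs⟩ := s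
  obtain ⟨⟨k', ⟨e', he'⟩⟩, hs'⟩ := s'
  change k = k' at h
  subst h
  have : e = e' := by change e + d k = n at hs; change e' + d k = n at hs'; omega
  subst this
  rfl

/-- `θ` of a source supported at one index. [folklore] -/
theorem lhMapT_single [DecidableEq ι] (W : Set X) {n : ℕ} (s₀ : LHSubset.Idx d n)
    (v : singularCohomology R R T s₀.deg) :
    lhMapT p d β hβ W n (Pi.single s₀ v) =
      (SimplexSpan.ofSet (R := R) W).cupRightH (SimplexSpan.frontBackClosed_ofSet _) (β s₀.cls) (hβ s₀.cls)
        s₀.2 (pullT p W s₀.deg v) := by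
  classical
  rw [lhMapT_apply, Finset.sum_eq_single s₀]
  · rw [Pi.single_eq_same]
  · intro s _ hs
    rw [Pi.single_eq_of_ne hs, map_zero, map_zero]
  · exact fun h ↦ absurd (Finset.mem_univ _) h

/-- `θ` of a source whose terms of class `≠ k₀` vanish is its `k₀`-term (if any). [folklore] -/
theorem lhMapT_eq_of_forall_ne (W : Set X) {n : ℕ} (k₀ : ι) (c : SrcT (R := R) (T := T) d n)
    (hvan : ∀ s : LHSubset.Idx d n, s.cls ≠ k₀ →
      (SimplexSpan.ofSet (R := R) W).cupRightH (SimplexSpan.frontBackClosed_ofSet _) (β s.cls) (hβ s.cls)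
        s.2 (pullT p W s.deg (c s)) = 0) :
    (d k₀ ≤ n → ∀ h : (n - d k₀) + d k₀ = n, lhMapT p d β hβ W n c =
      (SimplexSpan.ofSet (R := R) W).cupRightH (SimplexSpan.frontBackClosed_ofSet _) (β k₀) (hβ k₀)
        (idxOf k₀ (n - d k₀) h).2 (pullT p W (n - d k₀) (c (idxOf k₀ (n - d k₀) h)))) ∧
    (n < d k₀ → lhMapT p d β hβ W n c = 0) := by
  classical
  constructor
  · intro hle h
    rw [lhMapT_apply, Finset.sum_eq_single (idxOf k₀ (n - d k₀) h)]
    · intro s _ hs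
      exact hvan s (fun hk ↦ hs (idx_eq_of_cls_eq s _ hk))
    · exact fun h' ↦ absurd (Finset.mem_univ _) h'
  · intro hlt
    rw [lhMapT_apply]
    refine Finset.sum_eq_zero fun s _ ↦ hvan s fun hk ↦ ?_
    have := s.2
    rw [show s.1.1 = k₀ from hk] at this
    omega

/-! ### Vanishing and base-class summands -/

omit [Fintype ι] in
/-- If `β k` acts by zero on `H*_X(W)` then so on every pulled-back class of a subset. [folklore] -/
theorem cupRightH_pullT_eq_zero_of_subset {W S : Set X} (hS : S ⊆ W) (k : ι)
    (hk : ∀ (m n : ℕ) (h : m + d k = n) (y : (subsetCochains R 𝑹 W).homology m),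
      (SimplexSpan.ofSet (R := R) W).cupRightH (SimplexSpan.frontBackClosed_ofSet _) (β k) (hβ k) h y = 0)
    {m n : ℕ} (h : m + d k = n) (a : singularCohomology R R T m) :
    (SimplexSpan.ofSet (R := R) S).cupRightH (SimplexSpan.frontBackClosed_ofSet _) (β k) (hβ k) h
      (pullT p S m a) = 0 := by
  have h1 := (SimplexSpan.ofSet (R := R) W).homologyMap_dualMap_cupRightH
    (SimplexSpan.frontBackClosed_ofSet _) (β k) (hβ k) (SimplexSpan.ofSet (R := R) S) (chainsInSub_mono R R hS)
    (SimplexSpan.frontBackClosed_ofSet _) (fun hσ ↦ hσ.trans hS) h (pullT p W m a)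
  have h2 : resH (N := 𝑹) hS n ((SimplexSpan.ofSet (R := R) W).cupRightH (SimplexSpan.frontBackClosed_ofSet _)
      (β k) (hβ k) h (pullT p W m a)) = 0 := by
    rw [hk, map_zero]
  exact ((congrArg _ (resH_pullT p hS m a)).symm.trans h1.symm).trans h2

/-- `⌣ β` only depends on the cochain `β` (for rewriting `β b = p^♯φ_b`). [folklore] -/
theorem cupRightH_congr_fun (𝒮 : SimplexSpan R X) (h𝒮 : 𝒮.FrontBackClosed) {e : ℕ}
    {β₁ β₂ : SingularSimplex X e → R} (he : β₁ = β₂)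
    (h₁ : (singularCochainComplex R R X).d e (e + 1) β₁ = 0)
    (h₂ : (singularCochainComplex R R X).d e (e + 1) β₂ = 0) {m n : ℕ} (h : m + e = n) :
    𝒮.cupRightH h𝒮 β₁ h₁ h = 𝒮.cupRightH h𝒮 β₂ h₂ h := by
  subst he
  rfl

/-- **Over a piece where only the pulled-back cocycle `β b = p^♯φ_b` acts, `θ` takes values in
`p*(H*(T))`.** [folklore] -/
theorem exists_lhMapT_eq_pullT (W : Set X) (b : ι) (φb : SingularSimplex T (d b) → R)
    (hφb : (singularCochainComplex R R T).d (d b) (d b + 1) φb = 0)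
    (hb : β b = (singularCochainComplex.map R R p).f (d b) φb)
    (hvan : ∀ k, k ≠ b → ∀ (m n : ℕ) (h : m + d k = n) (a : singularCohomology R R T m),
      (SimplexSpan.ofSet (R := R) W).cupRightH (SimplexSpan.frontBackClosed_ofSet _) (β k) (hβ k) h
        (pullT p W m a) = 0)
    (n : ℕ) (c : SrcT (R := R) (T := T) d n) : ∃ a : singularCohomology R R T n, lhMapT p d β hβ W n c = pullT p W n a := by
  obtain ⟨h1, h2⟩ := lhMapT_eq_of_forall_ne p d β hβ W b c (fun s hs ↦ hvan s.cls hs _ _ s.2 (c s))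
  by_cases hle : d b ≤ n
  · refine ⟨cupProduct (show (n - d b) + d b = n by omega) (c (idxOf b (n - d b) (by omega)))
      (clsOfCocycle φb hφb), ?_⟩
    rw [h1 hle (by omega), cupRightH_congr_fun _ _ hb (hβ b) (map_d_eq_zero p φb hφb), cupRightH_pullT]
  · exact ⟨0, by rw [h2 (by omega), map_zero]⟩

/-! ### Commuting the top class past a base class -/

omit [Fintype ι] in
/-- **`(p*1 ⌣ β_t) ⌣ p^♯φ = p*[φ] ⌣ β_t`** for `β_t` of even degree (associativity and graded
commutativity of the cup product, Hatcher Thm. 3.11, transported through the comparison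
`H*_X(W) ≅ H*(↥W)`). [cite: HatcherAT2002, Thm. 3.11] -/
theorem sAct_cupRightH_pullT_one (W : Set X) (t : ι) (ht : Even (d t)) {N e n : ℕ}
    (h2 : 0 + d t = N + 1) (h1 : (N + 1) + e = n) (h3 : e + d t = n)
    (φ : SingularSimplex T e → R) (hφ : (singularCochainComplex R R T).d e (e + 1) φ = 0) :
    sAct p W h1 φ hφ ((SimplexSpan.ofSet (R := R) W).cupRightH (SimplexSpan.frontBackClosed_ofSet _)
        (β t) (hβ t) h2 (pullT p W 0 (singularCohomology.one R T))) =
      (SimplexSpan.ofSet (R := R) W).cupRightH (SimplexSpan.frontBackClosed_ofSet _) (β t) (hβ t) h3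
        (pullT p W e (clsOfCocycle φ hφ)) := by
  apply iso_injective
  rw [sAct_apply, homologyIsoSingularCohomology_hom_cupRightH, homologyIsoSingularCohomology_hom_cupRightH,
    homologyIsoSingularCohomology_hom_cupRightH, iso_pullT, iso_pullT, clsOfCocycle_map,
    ← ModuleCat.comp_apply (f := singularCohomology.map R R p e), ← singularCohomology.map_comp,
    singularCohomology.map_one]
  have hqr : d t + e = n := by omega
  rw [cupProduct_assoc h2 hqr h1 (Nat.zero_add n), cupProduct_gradedComm_holds R (↥W) hqr h3,
    Even.neg_one_pow (ht.mul_right e), one_smul, one_cupProduct]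

/-! ### The fibre step -/

section FibreStep

variable {A C : Set X} (hAo : IsOpen A) (hCo : IsOpen C) (b t : ι) (PC : ι → Prop)
  -- over `A`: only the pulled-back bottom cocycle acts
  (hA : ∀ j, Function.Bijective (pullT (R := R) p A j))
  (φb : SingularSimplex T (d b) → R) (hφb : (singularCochainComplex R R T).d (d b) (d b + 1) φb = 0)
  (hb : β b = (singularCochainComplex.map R R p).f (d b) φb)
  (hA' : ∀ k, k ≠ b → ∀ (m n : ℕ) (h : m + d k = n) (y : (subsetCochains R (SimplexSpan.coefR R) A).homology m),
    (SimplexSpan.ofSet (R := R) A).cupRightH (SimplexSpan.frontBackClosed_ofSet _) (β k) (hβ k) h y = 0)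
  -- over `C`: Leray–Hirsch for the indices outside `PC`, and the `β k`, `k ∈ PC ∋ t`, act by zero
  (hPt : PC t) (hC : IsLHTR p d β hβ PC C)
  (hC' : ∀ k, PC k → ∀ (m n : ℕ) (h : m + d k = n) (y : (subsetCochains R (SimplexSpan.coefR R) C).homology m),
    (SimplexSpan.ofSet (R := R) C).cupRightH (SimplexSpan.frontBackClosed_ofSet _) (β k) (hβ k) h y = 0)
  -- the sphere class
  {N : ℕ} (ht : Even (d t)) (hN : 0 + d t = N + 1) {s : (subsetCochains R (SimplexSpan.coefR R) (A ∩ C)).homology N}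
  (hS : TwoSummand p (A ∩ C) N s) (u : Rˣ)
  (hδ : mvδ R (SimplexSpan.coefR R) hAo hCo N s = (u : R) • (SimplexSpan.ofSet (R := R) (A ∪ C)).cupRightH
    (SimplexSpan.frontBackClosed_ofSet _) (β t) (hβ t) hN (pullT p (A ∪ C) 0 (singularCohomology.one R T)))

include hφb hb hA' in
/-- Over `A`, `θ` takes values in `p*(H*(T))`. [folklore] -/
theorem exists_lhMapT_A_eq_pullT (n : ℕ) (c : SrcT (R := R) (T := T) d n) :
    ∃ a : singularCohomology R R T n, lhMapT p d β hβ A n c = pullT p A n a :=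
  exists_lhMapT_eq_pullT p d β hβ A b φb hφb hb (fun k hk m n h _ ↦ hA' k hk m n h _) n c

include hφb hb hA' in
/-- Over `A ∩ C`, `θ` takes values in `p*(H*(T))`. [folklore] -/
theorem exists_lhMapT_S_eq_pullT (n : ℕ) (c : SrcT (R := R) (T := T) d n) :
    ∃ a : singularCohomology R R T n, lhMapT p d β hβ (A ∩ C) n c = pullT p (A ∩ C) n a :=
  exists_lhMapT_eq_pullT p d β hβ (A ∩ C) b φb hφb hb
    (fun k hk _ _ h a ↦ cupRightH_pullT_eq_zero_of_subset p d β hβ Set.inter_subset_left k (hA' k hk) h a) n c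

include hC' in
omit [Fintype ι] in
/-- Over `C`, the terms of the classes in `PC` vanish. [folklore] -/
theorem lhMapT_C_term_eq_zero {n : ℕ} (s₀ : LHSubset.Idx d n) (hs : PC s₀.cls)
    (v : singularCohomology R R T s₀.deg) :
    (SimplexSpan.ofSet (R := R) C).cupRightH (SimplexSpan.frontBackClosed_ofSet _) (β s₀.cls) (hβ s₀.cls)
      s₀.2 (pullT p C s₀.deg v) = 0 :=
  hC' _ hs _ _ _ _

include hAo hCo hA hφb hb hA' hC ht hS hδ in
/-- **Surjectivity of `θ` over `A ∪ C`** by sources vanishing at the classes of `PC` other than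
`t` (the second four-lemma chase of the fibre step). [cite: HusemollerFibreBundles1994, Ch. 17 §2 Thm. 2.5] -/
theorem lhMapT_union_surjective (n : ℕ) (z : (subsetCochains R 𝑹 (A ∪ C)).homology n) :
    ∃ c : SrcT (R := R) (T := T) d n, (∀ s' : LHSubset.Idx d n, PC s'.cls → s'.cls ≠ t → c s' = 0) ∧
      lhMapT p d β hβ (A ∪ C) n c = z := by
  classical
  -- match `z` on `C`
  obtain ⟨c', hc'P, hc'⟩ := (hC n).2 (resH (N := 𝑹) Set.subset_union_right n z)
  have hc'P' : ∀ s' : LHSubset.Idx d n, PC s'.cls → s'.cls ≠ t → c' s' = 0 := fun s' h _ ↦ hc'P s' h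
  set z₁ := z - lhMapT p d β hβ (A ∪ C) n c' with hz₁
  have hzC : resH (N := 𝑹) (Set.subset_union_right : C ⊆ A ∪ C) n z₁ = 0 := by
    rw [hz₁, map_sub, resH_lhMapT, hc', sub_self]
  -- on `A`, `z₁` is a pulled-back base class, which vanishes since it vanishes on `A ∩ C`
  obtain ⟨α, hα⟩ := (hA n).2 (resH (N := 𝑹) Set.subset_union_left n z)
  obtain ⟨a', ha'⟩ := exists_lhMapT_A_eq_pullT p d β hβ b φb hφb hb hA' n c'
  have hzA' : resH (N := 𝑹) (Set.subset_union_left : A ⊆ A ∪ C) n z₁ = pullT p A n (α - a') := by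
    rw [hz₁, map_sub, resH_lhMapT, ha', ← hα, map_sub]
  have hαa : α - a' = 0 := by
    apply hS.pullT_eq_zero
    rw [← resH_pullT p (Set.inter_subset_left : A ∩ C ⊆ A), ← hzA', LHSubset.resH_resH_apply,
      ← LHSubset.resH_resH_apply Set.subset_union_right Set.inter_subset_right, hzC, map_zero]
  have hzA : resH (N := 𝑹) (Set.subset_union_left : A ⊆ A ∪ C) n z₁ = 0 := by
    rw [hzA', hαa, map_zero]
  obtain _ | n := n
  · -- degree `0`
    refine ⟨c', hc'P', ?_⟩
    have h0 : z₁ = 0 := eq_zero_of_resH_zero _ hzA hzC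
    rw [hz₁, sub_eq_zero] at h0
    exact h0.symm
  · obtain ⟨w, hw⟩ := exists_of_res_eq_zero hAo hCo z₁ hzA hzC
    by_cases hn : n < N
    · -- no sphere summand: `w` is a base class and `δ w = 0`
      obtain ⟨α', rfl⟩ := hS.surj_lt n hn w
      refine ⟨c', hc'P', ?_⟩
      rw [mvδ_pullT] at hw
      have h0 : z₁ = 0 := hw.symm
      rw [hz₁, sub_eq_zero] at h0
      exact h0.symm
    · -- `w = p*α' + s ⌣ p^♯φ`, so `δ w = u • (p*1 ⌣ β_t) ⌣ p^♯φ = p*(u[φ]) ⌣ β_t`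
      obtain ⟨e, rfl⟩ : ∃ e, n = N + e := ⟨n - N, by omega⟩
      obtain ⟨α', φ, hφ, rfl⟩ := hS.surj e (N + e) rfl w
      have h3 : e + d t = N + e + 1 := by omega
      rw [map_add, mvδ_pullT, zero_add, mvδ_sAct, hδ, map_smul,
        sAct_cupRightH_pullT_one p d β hβ (A ∪ C) t ht hN _ h3] at hw
      have h5 : lhMapT p d β hβ (A ∪ C) (N + e + 1) (Pi.single (idxOf t e h3) ((u : R) • clsOfCocycle φ hφ)) =
          (u : R) • (SimplexSpan.ofSet (R := R) (A ∪ C)).cupRightH (SimplexSpan.frontBackClosed_ofSet _)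
            (β t) (hβ t) h3 (pullT p (A ∪ C) e (clsOfCocycle φ hφ)) := by
        rw [lhMapT_single, map_smul, map_smul]
      refine ⟨c' + Pi.single (idxOf t e h3) ((u : R) • clsOfCocycle φ hφ), fun s' hs' hs't ↦ ?_, ?_⟩
      · rw [Pi.add_apply, hc'P' s' hs' hs't, zero_add, Pi.single_eq_of_ne]
        exact fun h ↦ hs't (by rw [h])
      · rw [map_add, h5, hw, hz₁, add_sub_cancel]

include hAo hCo hA hφb hb hA' hPt hC hC' ht hS hδ in
/-- **Injectivity (zero kernel) of `θ` over `A ∪ C`** on sources vanishing at the classes of `PC`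
other than `t` (the first four-lemma chase of the fibre step). [cite: HusemollerFibreBundles1994, Ch. 17 §2 Thm. 2.5] -/
theorem lhMapT_union_injective (n : ℕ) (c : SrcT (R := R) (T := T) d n)
    (hcP : ∀ s' : LHSubset.Idx d n, PC s'.cls → s'.cls ≠ t → c s' = 0)
    (h0 : lhMapT p d β hβ (A ∪ C) n c = 0) : c = 0 := by
  classical
  -- split `c = c₀ + c₁` with `c₁` supported at the class `t`
  set c₁ : SrcT (R := R) (T := T) d n := fun s' ↦ if s'.cls = t then c s' else 0 with hc₁
  set c₀ : SrcT (R := R) (T := T) d n := c - c₁ with hc₀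
  have hc₀t : ∀ s' : LHSubset.Idx d n, PC s'.cls → c₀ s' = 0 := fun s' hs' ↦ by
    rw [hc₀, Pi.sub_apply, hc₁]
    by_cases hst : s'.cls = t
    · simp only [hst, if_true, sub_self]
    · simp only [hst, if_false, sub_zero]
      exact hcP s' hs' hst
  have hc₁C : lhMapT p d β hβ C n c₁ = 0 := by
    rw [lhMapT_apply]
    refine Finset.sum_eq_zero fun s' _ ↦ ?_
    by_cases hs' : s'.cls = t
    · exact lhMapT_C_term_eq_zero p d β hβ PC hC' s' (by rw [hs']; exact hPt) _
    · rw [hc₁]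
      simp only [hs', if_false, map_zero]
  -- over `C`: `θ_C c₀ = θ_C c = 0`, hence `c₀ = 0`
  have hC0 : lhMapT p d β hβ C n c₀ = 0 := by
    rw [hc₀, map_sub, hc₁C, sub_zero, ← resH_lhMapT p d β hβ (Set.subset_union_right : C ⊆ A ∪ C), h0,
      map_zero]
  have hc₀0 : c₀ = 0 := (hC n).1 c₀ hc₀t hC0
  have hcc : c = c₁ := by rw [← sub_eq_zero]; exact hc₀0
  -- the `t`-term
  by_cases hlt : n < d t
  · -- no index of class `t`
    rw [hcc]
    funext s'
    rw [hc₁, Pi.zero_apply]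
    by_cases hs' : s'.cls = t
    · exfalso
      have := s'.2
      rw [show s'.1.1 = t from hs'] at this
      omega
    · simp only [hs', if_false]
  · obtain ⟨e, he⟩ : ∃ e, e + d t = n := ⟨n - d t, by omega⟩
    set s₀ : LHSubset.Idx d n := idxOf t e he with hs₀
    have hc₁s : c₁ = Pi.single s₀ (c s₀) := by
      funext s'
      by_cases hs' : s'.cls = t
      · have : s' = s₀ := idx_eq_of_cls_eq s' s₀ hs'
        subst this
        rw [Pi.single_eq_same, hc₁]
        simp only [hs', if_true]
      · rw [Pi.single_eq_of_ne (fun h ↦ hs' (by rw [h])), hc₁]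
        simp only [hs', if_false]
    -- `θ c₁ = p*(c s₀) ⌣ β_t = 0`; write `c s₀ = [φ]`
    obtain ⟨φ, hφ', hφ⟩ := homologyCls_surjective (K := singularCochainComplex R R T) (i := e) (c s₀)
    have hφ0 : (singularCochainComplex R R T).d e (e + 1) φ = 0 := (d_next_eq_zero_iff (up_next e) φ).1 hφ'
    have hcls : clsOfCocycle φ hφ0 = c s₀ := (homologyCls_congr rfl _ _).trans hφ
    have h1 : (SimplexSpan.ofSet (R := R) (A ∪ C)).cupRightH (SimplexSpan.frontBackClosed_ofSet _) (β t) (hβ t)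
        he (pullT p (A ∪ C) e (clsOfCocycle φ hφ0)) = 0 := by
      rw [hcls, ← lhMapT_single p d β hβ (A ∪ C) s₀, ← hc₁s, ← hcc, h0]
    -- hence `(s ⌣ p^♯φ)` has `δ = 0`
    have h2 : mvδ R 𝑹 hAo hCo (N + e) (sAct p (A ∩ C) rfl φ hφ0 s) = 0 := by
      rw [mvδ_sAct, hδ, map_smul, sAct_cupRightH_pullT_one p d β hβ (A ∪ C) t ht hN _ (by omega) φ hφ0]
      obtain rfl : n = N + e + 1 := by omega
      rw [h1, smul_zero]
    obtain ⟨x, y, hxy⟩ := exists_of_mvδ_eq_zero hAo hCo _ h2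
    obtain ⟨αx, rfl⟩ := (hA _).2 x
    obtain ⟨cy, -, rfl⟩ := (hC _).2 y
    obtain ⟨αy, hαy⟩ := exists_lhMapT_S_eq_pullT p d β hβ b φb hφb hb hA' _ cy
    rw [resH_pullT, resH_lhMapT, hαy, ← map_sub] at hxy
    have h3 : pullT p (A ∩ C) (N + e) (-(αx - αy)) + sAct p (A ∩ C) rfl φ hφ0 s = 0 := by
      rw [hxy, map_neg, neg_add_cancel]
    have hφz : clsOfCocycle φ hφ0 = 0 := (hS.inj e (N + e) rfl _ φ hφ0 h3).2
    rw [hcc, hc₁s, ← hcls, hφz, Pi.single_zero]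

include hAo hCo hA hφb hb hA' hPt hC hC' ht hS hδ in
/-- **The fibre step of the Leray–Hirsch theorem for projective bundles**: with the hypotheses of
this section (cell piece `A`, hyperplane piece `C` over which the classes of `PC ∋ t` vanish and
the others give Leray–Hirsch, sphere `A ∩ C` with `δ s = u • xᵗ`), the comparison map
`θ : ⊕ₛ H^{e(s)}(T) → H*_X(A ∪ C)` is bijective for the family of the classes outside `PC ∖ {t}`
(Husemoller Ch. 17 §2 Thm. 2.5: `1, x, …, xⁿ⁻¹` is an `H*(T)`-base of `H*(T × ℂPⁿ⁻¹)`, by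
induction on `n` through the hyperplane `ℂPⁿ⁻²`; Hatcher Example 3.40). [cite: HusemollerFibreBundles1994, Ch. 17 §2 Thm. 2.5] -/
theorem isLHTR_union : IsLHTR p d β hβ (fun k ↦ PC k ∧ k ≠ t) (A ∪ C) := fun n ↦
  ⟨fun c hc h0 ↦ lhMapT_union_injective p d β hβ hAo hCo b t PC hA φb hφb hb hA' hPt hC hC' ht hN hS u hδ n c
      (fun s' h h' ↦ hc s' ⟨h, h'⟩) h0,
    fun z ↦ by
      obtain ⟨c, hc, rfl⟩ := lhMapT_union_surjective p d β hβ hAo hCo b t PC hA φb hφb hb hA' hC ht hN hS u hδ n z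
      exact ⟨c, fun s' h ↦ hc s' h.1 h.2, rfl⟩⟩

end FibreStep

end subsetCochains

end Literature.AlgebraicTopology.SingularHomology
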